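import Mathlib.RingTheory.Coprime.Lemmas
import Mathlib.Analysis.SpecialFunctions.Complex.Circle
import HarnessLib

/-!
# Drappeau 2017, §5.5: the reciprocity identity (5.22) for the phase of `ℛ₁`

Topic `Literature/NumberTheory/Sieve`, part of the formalisation of §5 of S. Drappeau, Proc. London
Math. Soc. (3) 114 (2017) 684–732 = arXiv:1504.05549 (Theorem 5.1 = the named fact
`Literature.NumberTheory.Sieve.Drappeau2017_theorem51`; the tree has
`Drappeau2017_theorem51_of_S1`, reducing it to the estimate of `𝒮₁`, §5.4–5.5).  Everything here is
PROVED; no definition and no named fact is introduced.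

In §5.5 (arXiv p. 20) the residue class `μ mod W`, `W = q₀q₁q₂`, is defined by
`μ ≡ a₁ \\overline{a₂ n₀ n_j} (mod q₀q_j)` (`j = 1, 2`), where `(q₁,q₂) = 1`, `n₁ ≡ n₂ (mod q₀)`,
`(n₁,n₂) = 1`, `β` is supported on squarefrees (so `(n₀,n₁) = 1`) and the coprimality conditions
`(n₀n_j, q₀q_ja₂) = 1`, `(q₀q₁q₂, a₁a₂) = 1` hold.  The paper states the equality modulo `1`

  `μ/(q₀q₁q₂) ≡ a₁/(q₀q₁q₂a₂n₀n₁) + a₁ ((n₁−n₂)/q₀) \\overline{q₁a₂n₀n₂}/(n₁q₂)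
      − a₁ \\overline{q₀q₁q₂n₁}/(a₂n₀) (mod 1)`                                            (5.22)

"verified by multiplying each side by `q₀q₁q₂a₂n₀n₁` and checking the resulting congruence modulo
`a₂n₀`, `n₁q₀`, `q₀q₁` and `q₀q₂` respectively".  We prove it in the form
`Drappeau2017.reciprocity_dvd` (the integer divisibility `q₀q₁q₂a₂n₀n₁ ∣ Z`) and
`Drappeau2017.reciprocity_mod_one` (the difference of the two sides is an integer), hence
`Drappeau2017.cexp_reciprocity` (equality of the exponentials `e(·)`).  Note that `(n₁, q₂)` and
`(q₀, q₂)` need not be `1`; the proof therefore checks the congruence modulo `n₁q₂` jointly (after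
multiplication by `n₂`) and modulo `q₀q₂`, and assembles `q₀q₁ , q₀q₂ ⇒ q₀q₁q₂`,
`n₁q₂, q₀q₁q₂ ⇒ q₀q₁q₂n₁` (using `(n₁, q₀q₁) = 1`), `a₂n₀` coprime to the rest.

## References

* S. Drappeau, Proc. London Math. Soc. (3) 114 (2017) 684–732, arXiv:1504.05549, §5.5 (5.22).
  [cite: Drappeau2017, §5.5 (5.22)]
-/

namespace Literature.NumberTheory.Sieve

namespace Drappeau2017

/-- **The congruence behind (5.22).**  With `n₁ − n₂ = q₀t`, `μa₂n₀n₁ ≡ a₁ (q₀q₁)`,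
`μa₂n₀n₂ ≡ a₁ (q₀q₂)`, `u q₁a₂n₀n₂ ≡ 1 (n₁q₂)`, `v q₀q₁q₂n₁ ≡ 1 (a₂n₀)` and the coprimality
conditions `(q₁,q₂) = (n₁,q₀q₁) = (n₂,n₁q₂) = (a₂n₀, q₀q₁q₂n₁) = 1`, `q₀ ≠ 0`:
`q₀q₁q₂a₂n₀n₁ ∣ μa₂n₀n₁ − a₁ − a₁tu·q₀q₁a₂n₀ + a₁v·q₀q₁q₂n₁`. [cite: Drappeau2017, §5.5 (5.22)] -/
theorem reciprocity_dvd {q₀ q₁ q₂ n₀ n₁ n₂ a₁ a₂ μ u v t : ℤ} (hq₀ : q₀ ≠ 0)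
    (hq : IsCoprime q₁ q₂) (hn₁ : IsCoprime n₁ (q₀ * q₁)) (hn₂ : IsCoprime n₂ (n₁ * q₂))
    (hA : IsCoprime (a₂ * n₀) (q₀ * q₁ * q₂ * n₁)) (ht : n₁ - n₂ = q₀ * t)
    (hμ₁ : q₀ * q₁ ∣ μ * a₂ * n₀ * n₁ - a₁) (hμ₂ : q₀ * q₂ ∣ μ * a₂ * n₀ * n₂ - a₁)
    (hu : n₁ * q₂ ∣ u * q₁ * a₂ * n₀ * n₂ - 1) (hv : a₂ * n₀ ∣ v * q₀ * q₁ * q₂ * n₁ - 1) :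
    q₀ * q₁ * q₂ * a₂ * n₀ * n₁ ∣
      μ * a₂ * n₀ * n₁ - a₁ - a₁ * t * u * (q₀ * q₁ * a₂ * n₀) + a₁ * v * (q₀ * q₁ * q₂ * n₁) := by
  obtain ⟨k₁, hk₁⟩ := hμ₁
  obtain ⟨k₂, hk₂⟩ := hμ₂
  obtain ⟨l, hl⟩ := hu
  obtain ⟨w, hw⟩ := hv
  -- modulo `a₂ n₀`
  have h1 : a₂ * n₀ ∣
      μ * a₂ * n₀ * n₁ - a₁ - a₁ * t * u * (q₀ * q₁ * a₂ * n₀) + a₁ * v * (q₀ * q₁ * q₂ * n₁) := by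
    refine ⟨μ * n₁ - a₁ * t * u * q₀ * q₁ + a₁ * w, ?_⟩
    linear_combination a₁ * hw
  -- modulo `q₀ q₁`
  have h2 : q₀ * q₁ ∣
      μ * a₂ * n₀ * n₁ - a₁ - a₁ * t * u * (q₀ * q₁ * a₂ * n₀) + a₁ * v * (q₀ * q₁ * q₂ * n₁) := by
    refine ⟨k₁ - a₁ * t * u * a₂ * n₀ + a₁ * v * q₂ * n₁, ?_⟩
    linear_combination hk₁
  -- modulo `q₀ q₂` : `q₂ ∣ μ − a₁ u q₁`
  have key : μ - a₁ * u * q₁ = q₂ * (u * q₁ * q₀ * k₂ - μ * n₁ * l) := by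
    linear_combination (u * q₁) * hk₂ + (-μ) * hl
  have h3 : q₀ * q₂ ∣
      μ * a₂ * n₀ * n₁ - a₁ - a₁ * t * u * (q₀ * q₁ * a₂ * n₀) + a₁ * v * (q₀ * q₁ * q₂ * n₁) := by
    refine ⟨k₂ + t * a₂ * n₀ * (u * q₁ * q₀ * k₂ - μ * n₁ * l) + a₁ * v * q₁ * n₁, ?_⟩
    linear_combination hk₂ + (μ * a₂ * n₀) * ht + (q₀ * t * a₂ * n₀) * key
  -- modulo `n₁ q₂` (jointly, after multiplication by `n₂`)
  have h4' : n₁ * q₂ ∣ n₂ *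
      (μ * a₂ * n₀ * n₁ - a₁ - a₁ * t * u * (q₀ * q₁ * a₂ * n₀) + a₁ * v * (q₀ * q₁ * q₂ * n₁)) := by
    refine ⟨q₀ * k₂ - a₁ * t * q₀ * l + a₁ * v * q₀ * q₁ * n₂, ?_⟩
    linear_combination n₁ * hk₂ + (-(a₁ * t * q₀)) * hl + a₁ * ht
  have h4 : n₁ * q₂ ∣
      μ * a₂ * n₀ * n₁ - a₁ - a₁ * t * u * (q₀ * q₁ * a₂ * n₀) + a₁ * v * (q₀ * q₁ * q₂ * n₁) :=
    (IsCoprime.symm hn₂).dvd_of_dvd_mul_left h4'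
  -- assemble: `q₀q₁, q₀q₂ ⇒ q₀q₁q₂`
  set Z := μ * a₂ * n₀ * n₁ - a₁ - a₁ * t * u * (q₀ * q₁ * a₂ * n₀) + a₁ * v * (q₀ * q₁ * q₂ * n₁)
    with hZ
  have h23 : q₀ * q₁ * q₂ ∣ Z := by
    obtain ⟨m, hm⟩ := h2
    have hq₂m : q₂ ∣ q₁ * m := by
      have : q₀ * q₂ ∣ q₀ * (q₁ * m) := by rw [← mul_assoc, ← hm]; exact h3
      exact (mul_dvd_mul_iff_left hq₀).1 this
    obtain ⟨m', hm'⟩ := (IsCoprime.symm hq).dvd_of_dvd_mul_left hq₂m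
    refine ⟨m', ?_⟩
    rw [hm, hm']; ring
  -- `n₁q₂, q₀q₁q₂ ⇒ q₀q₁q₂n₁`
  have h234 : q₀ * q₁ * q₂ * n₁ ∣ Z := by
    obtain ⟨m, hm⟩ := h23
    rcases eq_or_ne q₂ 0 with hq₂0 | hq₂0
    · -- then `q₁` is a unit and `Z = 0`
      refine ⟨0, ?_⟩
      rw [hm, hq₂0]; ring
    have hn₁m : n₁ ∣ q₀ * q₁ * m := by
      have : n₁ * q₂ ∣ q₂ * (q₀ * q₁ * m) := by
        have e : q₂ * (q₀ * q₁ * m) = Z := by rw [hm]; ring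
        rw [e]; exact h4
      rw [mul_comm n₁] at this
      exact (mul_dvd_mul_iff_left hq₂0).1 this
    obtain ⟨m', hm'⟩ := hn₁.dvd_of_dvd_mul_left hn₁m
    refine ⟨m', ?_⟩
    calc Z = q₂ * (q₀ * q₁ * m) := by rw [hm]; ring
      _ = q₂ * (q₀ * q₁ * (n₁ * m')) := by rw [hm']
      _ = q₀ * q₁ * q₂ * n₁ * m' := by ring
  -- `a₂n₀` coprime to `q₀q₁q₂n₁`
  have h := IsCoprime.mul_dvd hA h1 h234
  have e : a₂ * n₀ * (q₀ * q₁ * q₂ * n₁) = q₀ * q₁ * q₂ * a₂ * n₀ * n₁ := by ring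
  rwa [e] at h

/-- **(5.22), equality modulo 1.**  Under the hypotheses of `reciprocity_dvd` (all moduli non-zero),
`μ/(q₀q₁q₂) − [a₁/(q₀q₁q₂a₂n₀n₁) + a₁ t u/(n₁q₂) − a₁ v/(a₂n₀)] ∈ ℤ`, where `t = (n₁−n₂)/q₀`,
`u ≡ \\overline{q₁a₂n₀n₂} (mod n₁q₂)`, `v ≡ \\overline{q₀q₁q₂n₁} (mod a₂n₀)`.
[cite: Drappeau2017, §5.5 (5.22)] -/
theorem reciprocity_mod_one {q₀ q₁ q₂ n₀ n₁ n₂ a₁ a₂ μ u v t : ℤ} (hq₀ : q₀ ≠ 0) (hq₁0 : q₁ ≠ 0)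
    (hq₂0 : q₂ ≠ 0) (hn₀0 : n₀ ≠ 0) (hn₁0 : n₁ ≠ 0) (ha₂ : a₂ ≠ 0)
    (hq : IsCoprime q₁ q₂) (hn₁ : IsCoprime n₁ (q₀ * q₁)) (hn₂ : IsCoprime n₂ (n₁ * q₂))
    (hA : IsCoprime (a₂ * n₀) (q₀ * q₁ * q₂ * n₁)) (ht : n₁ - n₂ = q₀ * t)
    (hμ₁ : q₀ * q₁ ∣ μ * a₂ * n₀ * n₁ - a₁) (hμ₂ : q₀ * q₂ ∣ μ * a₂ * n₀ * n₂ - a₁)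
    (hu : n₁ * q₂ ∣ u * q₁ * a₂ * n₀ * n₂ - 1) (hv : a₂ * n₀ ∣ v * q₀ * q₁ * q₂ * n₁ - 1) :
    ∃ k : ℤ, (μ : ℝ) / ((q₀ : ℝ) * q₁ * q₂) =
      (a₁ : ℝ) / ((q₀ : ℝ) * q₁ * q₂ * a₂ * n₀ * n₁) + (a₁ : ℝ) * t * u / ((n₁ : ℝ) * q₂) -
        (a₁ : ℝ) * v / ((a₂ : ℝ) * n₀) + k := by
  obtain ⟨k, hk⟩ := reciprocity_dvd hq₀ hq hn₁ hn₂ hA ht hμ₁ hμ₂ hu hv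
  refine ⟨k, ?_⟩
  have hq₀' : (q₀ : ℝ) ≠ 0 := by exact_mod_cast hq₀
  have hq₁' : (q₁ : ℝ) ≠ 0 := by exact_mod_cast hq₁0
  have hq₂' : (q₂ : ℝ) ≠ 0 := by exact_mod_cast hq₂0
  have hn₀' : (n₀ : ℝ) ≠ 0 := by exact_mod_cast hn₀0
  have hn₁' : (n₁ : ℝ) ≠ 0 := by exact_mod_cast hn₁0
  have ha₂' : (a₂ : ℝ) ≠ 0 := by exact_mod_cast ha₂
  have hk' : ((μ * a₂ * n₀ * n₁ - a₁ - a₁ * t * u * (q₀ * q₁ * a₂ * n₀) +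
      a₁ * v * (q₀ * q₁ * q₂ * n₁) : ℤ) : ℝ) = ((q₀ * q₁ * q₂ * a₂ * n₀ * n₁ * k : ℤ) : ℝ) := by
    rw [hk]
  push_cast at hk'
  field_simp
  linear_combination hk'

/-- **(5.22) for the exponentials**: `e(hμ/(q₀q₁q₂)) = e(h a₁/(q₀q₁q₂a₂n₀n₁)) ·
e(a₁h t u/(n₁q₂)) · e(−a₁h v/(a₂n₀))` for every integer `h`, under the hypotheses of
`reciprocity_mod_one` (`e(x) = exp(2πix)`). [cite: Drappeau2017, §5.5 (5.22)] -/
theorem cexp_reciprocity {q₀ q₁ q₂ n₀ n₁ n₂ a₁ a₂ μ u v t : ℤ} (hq₀ : q₀ ≠ 0) (hq₁0 : q₁ ≠ 0)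
    (hq₂0 : q₂ ≠ 0) (hn₀0 : n₀ ≠ 0) (hn₁0 : n₁ ≠ 0) (ha₂ : a₂ ≠ 0)
    (hq : IsCoprime q₁ q₂) (hn₁ : IsCoprime n₁ (q₀ * q₁)) (hn₂ : IsCoprime n₂ (n₁ * q₂))
    (hA : IsCoprime (a₂ * n₀) (q₀ * q₁ * q₂ * n₁)) (ht : n₁ - n₂ = q₀ * t)
    (hμ₁ : q₀ * q₁ ∣ μ * a₂ * n₀ * n₁ - a₁) (hμ₂ : q₀ * q₂ ∣ μ * a₂ * n₀ * n₂ - a₁)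
    (hu : n₁ * q₂ ∣ u * q₁ * a₂ * n₀ * n₂ - 1) (hv : a₂ * n₀ ∣ v * q₀ * q₁ * q₂ * n₁ - 1) (h : ℤ) :
    Complex.exp (2 * Real.pi * Complex.I * (h * μ / ((q₀ : ℂ) * q₁ * q₂))) =
      Complex.exp (2 * Real.pi * Complex.I * (h * a₁ / ((q₀ : ℂ) * q₁ * q₂ * a₂ * n₀ * n₁))) *
        Complex.exp (2 * Real.pi * Complex.I * (h * a₁ * t * u / ((n₁ : ℂ) * q₂))) *
        Complex.exp (2 * Real.pi * Complex.I * (-(h * a₁ * v / ((a₂ : ℂ) * n₀)))) := by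
  obtain ⟨k, hk⟩ := reciprocity_mod_one hq₀ hq₁0 hq₂0 hn₀0 hn₁0 ha₂ hq hn₁ hn₂ hA ht hμ₁ hμ₂ hu hv
  rw [← Complex.exp_add, ← Complex.exp_add]
  -- the exponents differ by `2πi (h k)`
  have hkC : (μ : ℂ) / ((q₀ : ℂ) * q₁ * q₂) =
      (a₁ : ℂ) / ((q₀ : ℂ) * q₁ * q₂ * a₂ * n₀ * n₁) + (a₁ : ℂ) * t * u / ((n₁ : ℂ) * q₂) -
        (a₁ : ℂ) * v / ((a₂ : ℂ) * n₀) + k := by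
    have := congrArg (fun r : ℝ => (r : ℂ)) hk
    push_cast at this
    exact this
  have hexp : 2 * Real.pi * Complex.I * (h * μ / ((q₀ : ℂ) * q₁ * q₂)) =
      2 * Real.pi * Complex.I * (h * a₁ / ((q₀ : ℂ) * q₁ * q₂ * a₂ * n₀ * n₁)) +
        2 * Real.pi * Complex.I * (h * a₁ * t * u / ((n₁ : ℂ) * q₂)) +
        2 * Real.pi * Complex.I * (-(h * a₁ * v / ((a₂ : ℂ) * n₀))) +
        ((h * k : ℤ) : ℂ) * (2 * Real.pi * Complex.I) := by
    have e1 : (h : ℂ) * μ / ((q₀ : ℂ) * q₁ * q₂) = h * ((μ : ℂ) / ((q₀ : ℂ) * q₁ * q₂)) := by ring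
    rw [e1, hkC]
    push_cast
    ring
  rw [hexp, Complex.exp_add, Complex.exp_int_mul_two_pi_mul_I, mul_one]

end Drappeau2017

end Literature.NumberTheory.Sieve
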